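import Mathlib
import Summits.NavierStokesRegularity.NavierStokesRegularity.Theorems.ThreadingFluxHorizonTowerFiniteTowerDefs
import Summits.NavierStokesRegularity.NavierStokesRegularity.Theorems.ThreadingFluxHorizonTowerFiniteTowerOppositeTop
import HarnessLib

/-!
# Crux `PoloidalLiouville` (stmt-NavierStokesRegularity-1222), crux idea «horizon-threading-tower» (ns-idea-15):
# `FiniteTowerOppositeParityTopHorizonTowerZonality` BY NAME (THM C′, opposite-parity top pair)

Support file (`--supports stmt-NavierStokesRegularity-1222`, helper; cell `ns-wall-extremal`, width hand ns-wall-eng-3 g5; 0 kit).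
The typed statement (`Theorems/ThreadingFluxHorizonTowerFiniteTowerDefs.lean`, append VII) is closed by name from
`finiteTower_zonalForm_of_oppositeParityTop` (`…FiniteTowerOppositeTop`): the Defs-shaped binders (`D := K.max'`,
`D′ := (K.erase D).max'`, `a := (K.filter (· ≠ D ∧ · ≡ D mod 2)).max'`) are unfolded into the working binders.
HONEST LABEL: special cases of the crux-idea conjecture `HorizonTowerZonality` (finite towers, order one, a side condition on three
shells); general towers, `PoloidalLiouville` (1222) OPEN; W1 movement 0; NS regularity NOT proved.
-/

-- the summit and its single sub-problem share the name (CONVENTIONS §1)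
set_option linter.dupNamespace false

noncomputable section

namespace Summit.NavierStokesRegularity.NavierStokesRegularity.Theorems.PoloidalLiouville.HorizonTower

/-- ★★ `FiniteTowerOppositeParityTopHorizonTowerZonality` BY NAME (THM C′, opposite-parity top pair). -/
theorem finiteTowerOppositeParityTopHorizonTowerZonality : FiniteTowerOppositeParityTopHorizonTowerZonality := by
  intro K H hK hK' hKs hK1 hH hhom hharm hpar hiso hD0 hD'0 ha0 hcop hL1
  set D := K.max' hK with hDdef
  set D' := (K.erase D).max' hK' with hD'def
  set S := (K.filter fun l => l ≠ D ∧ l % 2 = D % 2) with hSdef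
  set a := S.max' hKs with hadef
  have hD : D ∈ K := Finset.max'_mem K hK
  have hmax : ∀ l ∈ K, l ≤ D := fun l hl => Finset.le_max' K l hl
  have hD'e : D' ∈ K.erase D := Finset.max'_mem _ hK'
  have hD' : D' ∈ K := Finset.mem_of_mem_erase hD'e
  have hlt : D' < D := lt_of_le_of_ne (hmax D' hD') (Finset.ne_of_mem_erase hD'e)
  have hsec : ∀ l ∈ K, l ≠ D → l ≤ D' := fun l hl hne => Finset.le_max' _ l (Finset.mem_erase.mpr ⟨hne, hl⟩)
  have haS : a ∈ S := Finset.max'_mem S hKs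
  have haK : a ∈ K := (Finset.mem_filter.mp haS).1
  have haD : a ≠ D := (Finset.mem_filter.mp haS).2.1
  have hapar : a % 2 = D % 2 := (Finset.mem_filter.mp haS).2.2
  have hamax : ∀ l ∈ K, l ≠ D → l % 2 = D % 2 → l ≤ a := fun l hl hne hp =>
    Finset.le_max' S l (Finset.mem_filter.mpr ⟨hl, hne, hp⟩)
  exact finiteTower_zonalForm_of_oppositeParityTop K H hK1 hH hhom hharm hL1 hD hD' hlt hmax hsec hpar haK haD hapar hamax hiso
    hcop hD0 hD'0 ha0

end Summit.NavierStokesRegularity.NavierStokesRegularity.Theorems.PoloidalLiouville.HorizonTower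

end
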